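import Summits.QuantumFields.YangMills.Theorems.ForcedResponseSkewnessAssemblyGlue
import Summits.QuantumFields.YangMills.Theorems.ForcedResponseSkewnessResponseLocalisationStubShell
import HarnessLib

/-!
# Route `ForcedResponseSkewness`, crux `ResponseLocalisation` (stmt-QuantumFields-24869): glue for the SIGNED collar share

Helper file (`--supports stmt-QuantumFields-24869`, seat `ym-line-frs-p2` g6).  The deciding crux (rev 5) bounds the
ABSOLUTE `δ`-collar mass `Σ_{x : infDist < δ} |respM x|` of the β-response profile; the route's Assembly only ever uses the
SIGNED collar share through the glue `relLocalisation_of_collar_far` (vet ym-vet-24869 g0/g2: "conclusion stronger than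
the signed share the glue needs").  This file records the signed form of that glue, so that a femto-isable (signed,
hypercubically smeared) contact statement can serve the Assembly:

* `relLocalisation_of_signedCollar_far` — for ONE source `v` on a window `[1, Λ']`: a SIGNED collar bound
  `|Σ_x χ(l·aβ·x) respM x| ≤ (η/2)(1 + |∂_cQ2|)` for SOME real Schwartz cut-off `χ` that equals `1` on a
  `δ`-thickening of `K = tsupport v ∪ tsupport θv` and vanishes outside a ball, together with the ABSOLUTE far-field
  mass `≤ (η/2)(1 + |∂_cQ2|)` beyond `D₀`, give a Schwartz `f` with `tsupport f` disjoint from `tsupport v`,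
  `tsupport θv` and the relative localisation `|∂_cQ2 − Q3(f,θv,v)| ≤ η(1 + |∂_cQ2|)`.  Source: `f := (1 − χ)·f_shell`
  with `f_shell` the landed plateau of `Birth.stub_shell` (p589598) at `(δ, D)`, `D ≥ D₀`, `D ≥` the radius of `χ`;
  then `1 − f = χ + (1 − f_shell)(1 − χ)` and the second weight is non-zero only beyond `D`, where it lies in `[0,1]`
  (exact split `Birth.stub_split`, p589535).
* `signedCollar_of_absCollar` — the absolute collar bound of the current crux text implies the signed one (Urysohn bump
  `χ ∈ [0,1]`, `χ = 1` on the `δ/2`-thickening, `supp χ ⊆ δ`-thickening; needs `K` bounded, i.e. `tsupport v` inside a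
  closed ball as in the crux): the signed form is a pure WEAKENING of the typed conclusion.

Honest label: bookkeeping on a conditional rung line (leaf R2a `BalabanLadder.NT`, residual stmt-QuantumFields-24873);
no stub of the crux is closed here; NT and the YM mass gap are NOT proved by this.
-/

set_option autoImplicit false

noncomputable section

namespace Summit.QuantumFields.YangMills.Theorems.ForcedResponseSkewness

open scoped BigOperators Topology SchwartzMap
open Filter Set MeasureTheory Metric
open Literature.MathematicalPhysics.QuantumFieldTheory Literature.MathematicalPhysics.QuantumLattice
open Literature.Probability.LatticeModels
open Summit.QuantumFields.YangMills.Cruxes.OSLegsFromFemtoAndGap.DlrCollarTransfer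
open Summit.QuantumFields.YangMills.Cruxes.ResponseLocalisation.Birth

/-- For `v = 0` the response profile vanishes identically. [folklore] -/
theorem respM_zero (G : Type) [Group G] [TopologicalSpace G] [IsTopologicalGroup G] [CompactSpace G]
    [MeasurableSpace G] [BorelSpace G] (r : LatticeRep G) (β : ℝ) (L : ℕ) (s : ℝ) (x : Fin 4 → ℤ) :
    respM G r β L s 0 x = 0 := by
  unfold respM
  simp

/-- **Signed collar + far ⇒ relative localisation (glue).**  For ONE source `v` on a window `[1, Λ']`: a signed collar
bound for some Schwartz cut-off `χ` (`χ = 1` on a `δ`-thickening of `tsupport v ∪ tsupport θv`, `χ = 0` outside a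
ball) at tolerance `η/2`, and the absolute far-field mass beyond `D₀` at tolerance `η/2`, give a Schwartz `f` supported
away from `tsupport v`, `tsupport θv` with `|∂_cQ2 − Q3(f,θv,v)| ≤ η(1 + |∂_cQ2|)` — `f := (1 − χ)·f_shell` with the
landed plateau `stub_shell` and the exact split `stub_split`. [folklore] -/
theorem relLocalisation_of_signedCollar_far (G : Type) [Group G] [TopologicalSpace G] [IsTopologicalGroup G]
    [CompactSpace G] (hG : IsCompactSimpleLieGroup G) :
    letI : MeasurableSpace G := borel G
    haveI : BorelSpace G := ⟨rfl⟩
    ∀ (r : LatticeRep G) (a : ℝ → ℝ) (v : 𝓢(EuclideanSpace ℝ (Fin 4), ℝ)) (η Λ' : ℝ), 0 < η →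
      (∃ δ : ℝ, 0 < δ ∧ ∃ χ : 𝓢(EuclideanSpace ℝ (Fin 4), ℝ),
        (∀ y ∈ Metric.thickening δ (tsupport v ∪ tsupport (thetaTest 4 v)), χ y = 1) ∧
        (∃ R₁ : ℝ, ∀ y : EuclideanSpace ℝ (Fin 4), R₁ < ‖y‖ → χ y = 0) ∧
        ∃ β₁ Λ₁ : ℝ, ∀ β : ℝ, β₁ ≤ β → ∀ L : ℕ, Λ₁ ≤ a β * L → ∀ l : ℝ, l ∈ Set.Icc 1 Λ' →
          |∑ x ∈ box 4 L, χ ((l * a β) • siteToE x) * respM G r β L (l * a β) v x| ≤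
            η / 2 * (1 + |deriv (fun c : ℝ => Q2 G r c L (l * a β) (thetaTest 4 v) v) β|)) →
      (∃ D : ℝ, 0 < D ∧ ∃ β₂ Λ₂ : ℝ, ∀ β : ℝ, β₂ ≤ β → ∀ L : ℕ, Λ₂ ≤ a β * L → ∀ l : ℝ, l ∈ Set.Icc 1 Λ' →
        (∑ x ∈ box 4 L, (if D < ‖(l * a β) • siteToE x‖ then |respM G r β L (l * a β) v x| else 0)) ≤
          η / 2 * (1 + |deriv (fun c : ℝ => Q2 G r c L (l * a β) (thetaTest 4 v) v) β|)) →
      ∃ f : 𝓢(EuclideanSpace ℝ (Fin 4), ℝ), Disjoint (tsupport f) (tsupport v) ∧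
        Disjoint (tsupport f) (tsupport (thetaTest 4 v)) ∧
        ∃ β₆ Λ₆ : ℝ, ∀ β : ℝ, β₆ ≤ β → ∀ L : ℕ, Λ₆ ≤ a β * L → ∀ l : ℝ, l ∈ Set.Icc 1 Λ' →
          |deriv (fun c : ℝ => Q2 G r c L (l * a β) (thetaTest 4 v) v) β - Q3 G r β L (l * a β) f (thetaTest 4 v) v| ≤
            η * (1 + |deriv (fun c : ℝ => Q2 G r c L (l * a β) (thetaTest 4 v) v) β|) := by
  letI : MeasurableSpace G := borel G
  haveI : BorelSpace G := ⟨rfl⟩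
  intro r a v η Λ' hη hC hF
  have hsplit : SplitSig := Summit.QuantumFields.YangMills.Cruxes.ResponseLocalisation.Birth.stub_split
  have hshell : ShellSig := Summit.QuantumFields.YangMills.Cruxes.ResponseLocalisation.Birth.stub_shell
  obtain ⟨δ, hδ, χ, hχ1, ⟨R₁, hχ0⟩, β₁, Λ₁, hC⟩ := hC
  obtain ⟨D₀, hD₀, β₂, Λ₂, hF⟩ := hF
  set K : Set (EuclideanSpace ℝ (Fin 4)) := tsupport v ∪ tsupport (thetaTest 4 v) with hK
  -- the plateau radius: beyond the far radius, beyond the cut-off radius, beyond `δ`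
  set D : ℝ := max (max D₀ R₁) (2 * δ) with hDdef
  have hδD : δ < D := lt_of_lt_of_le (by linarith) (le_max_right _ _)
  have hD₀D : D₀ ≤ D := le_trans (le_max_left _ _) (le_max_left _ _)
  have hR₁D : R₁ ≤ D := le_trans (le_max_right _ _) (le_max_left _ _)
  obtain ⟨fs, hfsv, hfsθ, hfs01, hfsone⟩ := hshell v δ D hδ hδD
  -- the source `f := (1 − χ) · f_shell`
  set g : EuclideanSpace ℝ (Fin 4) → ℝ := fun y => 1 - χ y with hgdef
  have hg : g.HasTemperateGrowth :=
    (Function.HasTemperateGrowth.const (1 : ℝ)).sub (SchwartzMap.hasTemperateGrowth χ)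
  set f : 𝓢(EuclideanSpace ℝ (Fin 4), ℝ) := SchwartzMap.smulLeftCLM ℝ g fs with hfdef
  have hf_apply : ∀ y, f y = (1 - χ y) * fs y := fun y => by
    rw [hfdef, SchwartzMap.smulLeftCLM_apply_apply hg, smul_eq_mul]
  have hf_coe : (f : EuclideanSpace ℝ (Fin 4) → ℝ) = fun y => g y • fs y := by
    funext y; rw [hf_apply y, smul_eq_mul]
  have hfts : tsupport (f : EuclideanSpace ℝ (Fin 4) → ℝ) ⊆ tsupport (fs : EuclideanSpace ℝ (Fin 4) → ℝ) := by
    rw [hf_coe]; exact tsupport_smul_subset_right _ _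
  refine ⟨f, hfsv.mono_left hfts, hfsθ.mono_left hfts, max β₁ β₂, max Λ₁ Λ₂, ?_⟩
  intro β hβ L hL l hl
  have hCβ := hC β (le_trans (le_max_left _ _) hβ) L (le_trans (le_max_left _ _) hL) l hl
  have hFβ := hF β (le_trans (le_max_right _ _) hβ) L (le_trans (le_max_right _ _) hL) l hl
  rw [hsplit G hG r β L (l * a β) v f]
  by_cases hv : v = 0
  · -- the zero source: the profile vanishes
    subst hv
    simp only [respM_zero, mul_zero, Finset.sum_const_zero, abs_zero]
    positivity
  -- `K` is nonempty, so `infDist < δ` means membership in the thickening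
  have hKne : K.Nonempty := by
    have h1 : (tsupport (v : EuclideanSpace ℝ (Fin 4) → ℝ)).Nonempty := by
      rw [Set.nonempty_iff_ne_empty, Ne, tsupport_eq_empty_iff]
      intro h0
      exact hv (by ext y; simpa using congrFun h0 y)
    exact h1.mono subset_union_left
  -- pointwise: `1 − f = χ + (1 − f_shell)(1 − χ)`, the second weight lives beyond `D` and is in `[0,1]`
  have hpt : ∀ x ∈ box 4 L,
      |(1 - f ((l * a β) • siteToE x)) * respM G r β L (l * a β) v x -
          χ ((l * a β) • siteToE x) * respM G r β L (l * a β) v x| ≤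
        (if D₀ < ‖(l * a β) • siteToE x‖ then |respM G r β L (l * a β) v x| else 0) := by
    intro x _
    set y := (l * a β) • siteToE x with hy
    set M := respM G r β L (l * a β) v x with hM
    have hw : (1 - f y) * M - χ y * M = ((1 - fs y) * (1 - χ y)) * M := by
      rw [hf_apply y]; ring
    rw [hw, abs_mul]
    have h01 := hfs01 y
    by_cases hyD : D < ‖y‖
    · -- beyond the plateau radius: `χ = 0`, weight `1 − f_shell ∈ [0,1]`
      have hχy : χ y = 0 := hχ0 y (lt_of_le_of_lt hR₁D hyD)
      rw [hχy, sub_zero, mul_one, if_pos (lt_of_le_of_lt hD₀D hyD)]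
      have hwt : |1 - fs y| ≤ 1 := by rw [abs_le]; constructor <;> linarith [h01.1, h01.2]
      calc |1 - fs y| * |M| ≤ 1 * |M| := mul_le_mul_of_nonneg_right hwt (abs_nonneg _)
        _ = |M| := one_mul _
    · rw [not_lt] at hyD
      have hzero : (1 - fs y) * (1 - χ y) = 0 := by
        by_cases hnear : infDist y K < δ
        · have hyth : y ∈ Metric.thickening δ K := by
            rw [Metric.mem_thickening_iff]
            obtain ⟨k, hk, hk'⟩ := (Metric.infDist_lt_iff hKne).1 hnear
            exact ⟨k, hk, hk'⟩
          rw [hχ1 y hyth, sub_self, mul_zero]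
        · rw [not_lt] at hnear
          rw [hfsone y hnear hyD, sub_self, zero_mul]
      rw [hzero, abs_zero, zero_mul]
      split_ifs <;> positivity
  -- sum: `|Σ (1−f)M| ≤ |Σ χM| + Σ |(1−f)M − χM|`
  have hdecomp : ∑ x ∈ box 4 L, (1 - f ((l * a β) • siteToE x)) * respM G r β L (l * a β) v x =
      (∑ x ∈ box 4 L, χ ((l * a β) • siteToE x) * respM G r β L (l * a β) v x) +
        ∑ x ∈ box 4 L, ((1 - f ((l * a β) • siteToE x)) * respM G r β L (l * a β) v x -
          χ ((l * a β) • siteToE x) * respM G r β L (l * a β) v x) := by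
    rw [← Finset.sum_add_distrib]
    refine Finset.sum_congr rfl fun x _ => by ring
  rw [hdecomp]
  calc |(∑ x ∈ box 4 L, χ ((l * a β) • siteToE x) * respM G r β L (l * a β) v x) +
          ∑ x ∈ box 4 L, ((1 - f ((l * a β) • siteToE x)) * respM G r β L (l * a β) v x -
            χ ((l * a β) • siteToE x) * respM G r β L (l * a β) v x)|
      ≤ |∑ x ∈ box 4 L, χ ((l * a β) • siteToE x) * respM G r β L (l * a β) v x| +
          |∑ x ∈ box 4 L, ((1 - f ((l * a β) • siteToE x)) * respM G r β L (l * a β) v x -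
            χ ((l * a β) • siteToE x) * respM G r β L (l * a β) v x)| := abs_add_le _ _
    _ ≤ |∑ x ∈ box 4 L, χ ((l * a β) • siteToE x) * respM G r β L (l * a β) v x| +
          ∑ x ∈ box 4 L, |(1 - f ((l * a β) • siteToE x)) * respM G r β L (l * a β) v x -
            χ ((l * a β) • siteToE x) * respM G r β L (l * a β) v x| := by
        gcongr; exact Finset.abs_sum_le_sum_abs _ _
    _ ≤ |∑ x ∈ box 4 L, χ ((l * a β) • siteToE x) * respM G r β L (l * a β) v x| +
          ∑ x ∈ box 4 L, (if D₀ < ‖(l * a β) • siteToE x‖ then |respM G r β L (l * a β) v x| else 0) := by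
        gcongr with x hx; exact hpt x hx
    _ ≤ η / 2 * (1 + |deriv (fun c : ℝ => Q2 G r c L (l * a β) (thetaTest 4 v) v) β|)
          + η / 2 * (1 + |deriv (fun c : ℝ => Q2 G r c L (l * a β) (thetaTest 4 v) v) β|) := add_le_add hCβ hFβ
    _ = η * (1 + |deriv (fun c : ℝ => Q2 G r c L (l * a β) (thetaTest 4 v) v) β|) := by ring

/-- **Absolute collar bound ⇒ signed collar bound.**  For a source `v` with compact support, the absolute `δ`-collar
mass bound of the current crux text yields the signed collar datum of `relLocalisation_of_signedCollar_far`: a smooth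
Urysohn bump `χ ∈ [0,1]`, `χ = 1` on the `δ/2`-thickening of `K = tsupport v ∪ tsupport θv`, `χ = 0` off the
`δ`-thickening (a bounded set), so `|Σ χ·respM| ≤ Σ_{infDist < δ} |respM|`.  The signed form is a WEAKENING. [folklore] -/
theorem signedCollar_of_absCollar (G : Type) [Group G] [TopologicalSpace G] [IsTopologicalGroup G]
    [CompactSpace G] [MeasurableSpace G] [BorelSpace G] (r : LatticeRep G) (a : ℝ → ℝ)
    (v : 𝓢(EuclideanSpace ℝ (Fin 4), ℝ)) (hv : HasCompactSupport (v : EuclideanSpace ℝ (Fin 4) → ℝ))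
    (Λ' : ℝ) (B : ℝ → ℕ → ℝ → ℝ)
    (hC : ∃ δ : ℝ, 0 < δ ∧ ∃ β₁ Λ₁ : ℝ, ∀ β : ℝ, β₁ ≤ β → ∀ L : ℕ, Λ₁ ≤ a β * L → ∀ l : ℝ, l ∈ Set.Icc 1 Λ' →
      (∑ x ∈ box 4 L, (if Metric.infDist ((l * a β) • siteToE x) (tsupport v ∪ tsupport (thetaTest 4 v)) < δ then
        |respM G r β L (l * a β) v x| else 0)) ≤ B β L l) :
    ∃ δ : ℝ, 0 < δ ∧ ∃ χ : 𝓢(EuclideanSpace ℝ (Fin 4), ℝ),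
      (∀ y ∈ Metric.thickening δ (tsupport v ∪ tsupport (thetaTest 4 v)), χ y = 1) ∧
      (∃ R₁ : ℝ, ∀ y : EuclideanSpace ℝ (Fin 4), R₁ < ‖y‖ → χ y = 0) ∧
      ∃ β₁ Λ₁ : ℝ, ∀ β : ℝ, β₁ ≤ β → ∀ L : ℕ, Λ₁ ≤ a β * L → ∀ l : ℝ, l ∈ Set.Icc 1 Λ' →
        |∑ x ∈ box 4 L, χ ((l * a β) • siteToE x) * respM G r β L (l * a β) v x| ≤ B β L l := by
  obtain ⟨δ, hδ, β₁, Λ₁, hC⟩ := hC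
  set K : Set (EuclideanSpace ℝ (Fin 4)) := tsupport v ∪ tsupport (thetaTest 4 v) with hK
  -- `K` is compact: `θv = v ∘ θ` with `θ` a homeomorphism
  have hθv : HasCompactSupport ((thetaTest 4 v : 𝓢(EuclideanSpace ℝ (Fin 4), ℝ)) :
      EuclideanSpace ℝ (Fin 4) → ℝ) := by
    have hcoe : ((thetaTest 4 v : 𝓢(EuclideanSpace ℝ (Fin 4), ℝ)) : EuclideanSpace ℝ (Fin 4) → ℝ) =
        (v : EuclideanSpace ℝ (Fin 4) → ℝ) ∘ (timeReflection 4).toHomeomorph := by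
      funext y; simp [thetaTest_apply]
    rw [hcoe]
    exact hv.comp_homeomorph _
  have hKc : IsCompact K := hv.isCompact.union hθv.isCompact
  set A : Set (EuclideanSpace ℝ (Fin 4)) := Metric.cthickening (δ / 2) K with hA
  set U : Set (EuclideanSpace ℝ (Fin 4)) := Metric.thickening δ K with hU
  have hAcpt : IsCompact A := hKc.cthickening
  have hUo : IsOpen U := Metric.isOpen_thickening
  have hAU : A ⊆ U := Metric.cthickening_subset_thickening' hδ (by linarith) K
  obtain ⟨g, hgd, hg1, hgs, hg01⟩ := exists_contDiff_plateau hAcpt hUo hAU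
  have hts : tsupport g ⊆ Metric.cthickening δ K :=
    (closure_mono hgs).trans (Metric.closure_thickening_subset_cthickening δ K)
  have hcpt : HasCompactSupport g :=
    IsCompact.of_isClosed_subset hKc.cthickening (isClosed_tsupport _) hts
  obtain ⟨R₁, hR₁⟩ := (hKc.cthickening (r := δ)).isBounded.subset_closedBall (0 : EuclideanSpace ℝ (Fin 4))
  set χ : 𝓢(EuclideanSpace ℝ (Fin 4), ℝ) := hcpt.toSchwartzMap hgd with hχdef
  have hχ : ∀ y, χ y = g y := fun y => rfl
  refine ⟨δ / 2, half_pos hδ, χ, ?_, ⟨R₁, ?_⟩, β₁, Λ₁, ?_⟩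
  · intro y hy
    rw [hχ]
    exact hg1 (Metric.thickening_subset_cthickening _ _ hy)
  · intro y hy
    rw [hχ]
    have hyc : y ∉ Metric.cthickening δ K := by
      intro h
      have := hR₁ h
      rw [mem_closedBall_zero_iff] at this
      linarith
    by_contra hne
    exact hyc (hts (subset_tsupport _ (Function.mem_support.2 hne)))
  · intro β hβ L hL l hl
    have hCβ := hC β hβ L hL l hl
    refine le_trans (Finset.abs_sum_le_sum_abs _ _) (le_trans (Finset.sum_le_sum fun x _ => ?_) hCβ)
    set y := (l * a β) • siteToE x with hy
    rw [abs_mul, hχ]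
    by_cases hgy : g y = 0
    · rw [hgy, abs_zero, zero_mul]
      split_ifs <;> positivity
    · have hyU : y ∈ U := hgs (Function.mem_support.2 hgy)
      have hlt : Metric.infDist y K < δ := by
        obtain ⟨k, hk, hk'⟩ := Metric.mem_thickening_iff.1 hyU
        exact lt_of_le_of_lt (Metric.infDist_le_dist_of_mem hk) hk'
      rw [if_pos hlt]
      have h01 := hg01 y
      have habs : |g y| ≤ 1 := by rw [abs_le]; constructor <;> linarith [h01.1, h01.2]
      calc |g y| * |respM G r β L (l * a β) v x| ≤ 1 * |respM G r β L (l * a β) v x| :=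
            mul_le_mul_of_nonneg_right habs (abs_nonneg _)
        _ = |respM G r β L (l * a β) v x| := one_mul _

end Summit.QuantumFields.YangMills.Theorems.ForcedResponseSkewness

end
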